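import Summits.ValiantsHypothesis.ValiantsHypothesis.Theorems.KPlusLogSqLawTridiagonalRealStaticHierarchyMove
import Summits.ValiantsHypothesis.ValiantsHypothesis.Theorems.SymmetroidPencilBasics

/-!
# Route «KPlusLogSqLaw», crux `WeakLifting` (stmt-ValiantsHypothesis-19561) — REAL side of the tridiagonal sector:
# sign-only analytic tools for the ∀-size LADDER (moves with even exponents, first/last-zero splits, fresh points, list alternation)

HONEST FRAMING.  Helper (`--supports stmt-ValiantsHypothesis-19561 --as helper`), seat val-sym-lift-p1 (g12), cell `pub-symmetroid`,
2026-08-27.  Pure real analysis (continuity, `sInf`, the Archimedean move lemma `exists_move_signs` of g11): the tools with which the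
seat's located ladder (memo ROTATING-DETECTOR-liftp1g11.md §3b: two hierarchical edges add three zeros) becomes an all-sizes kernel
row WITHOUT locating a single zero.  What is here:
* `exists_move_signs_sq` — the move lemma with an EVEN exponent `x^(2f)` (so that the appended edge is a monomial matrix entry
  `b·X^f` squared), derived from `exists_move_signs` by `u = x²`;
* `exists_split_first` / `exists_split_last` — if `q` changes sign on `[a, b]` and a continuous `h` is known to have sign `u` AT EVERY
  ZERO of `q` in `[a, b]`, then some `w ∈ (a, b)` has `q` of constant (certified) sign on `[a, w]` (resp. `[w, b]`) and `u·h w > 0` —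
  the first (last) zero of `q` by `sInf`, then continuity of `h`; this is how a «tight pair» of the limit game is separated by a
  sample point at finite slope;
* `exists_point_right₂` / `exists_point_left` — fresh sample points next to a point where continuous functions have known signs;
* `ne_zero_of_isChain_alt`, `le_card_posRoots_of_isChain` — a strictly increasing LIST of positive points along which a polynomial
  alternates in sign certifies `length − 1` distinct positive roots (the tree's `le_card_posRoots_of_alternating`, list form).
Nothing here is an upper bound; nothing bears on `WeakLifting` / `TropicalB` in their windows, Conjecture B, the doors,
`MatrixDescartes` (stmt-18050) or VP ≠ VNP.  [folklore: elementary real analysis]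
-/

-- `Summit.ValiantsHypothesis.ValiantsHypothesis.…` repeats a component by the D-0017 layout (single-conjunct summit); the name is mandated.
set_option linter.dupNamespace false
set_option autoImplicit false

namespace Summit.ValiantsHypothesis.ValiantsHypothesis.Theorems.KPlusLogSqLaw.StaticTridiagonalRealLadder

open Set Finset
open Summit.ValiantsHypothesis.ValiantsHypothesis.Theorems.KPlusLogSqLaw.StaticTridiagonalRealExcess (exists_move_signs)
open Summit.ValiantsHypothesis.ValiantsHypothesis.Theorems.SymmetroidDescartes (le_card_posRoots_of_alternating)

/-! ### The move lemma with an even exponent -/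

/-- **One move at finite slope, EVEN exponent.**  For `0 < r₁ < r₂`, finitely many points `xs ⊂ (0, r₁]` with `p ≠ 0` and `ys ⊂ [r₂, ∞)`
with `q ≠ 0`, there are `f : ℕ` and `κ > 0` such that `x ↦ p x − κ x^(2f) q x` has the sign of `p` on `xs` and of `−q` on `ys`.
(`exists_move_signs` in the variable `u = x²`.) [folklore: Archimedean] -/
theorem exists_move_signs_sq (p q : ℝ → ℝ) (xs ys : Finset ℝ) {r₁ r₂ : ℝ} (h₁ : 0 < r₁) (h₁₂ : r₁ < r₂)
    (hxs : ∀ x ∈ xs, 0 < x ∧ x ≤ r₁ ∧ p x ≠ 0) (hys : ∀ y ∈ ys, r₂ ≤ y ∧ q y ≠ 0) :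
    ∃ (f : ℕ) (κ : ℝ), 0 < κ ∧
      (∀ x ∈ xs, 0 < (p x - κ * x ^ (2 * f) * q x) * p x) ∧
      (∀ y ∈ ys, 0 < -((p y - κ * y ^ (2 * f) * q y) * q y)) := by
  have h₂ : 0 < r₂ := h₁.trans h₁₂
  have hxs' : ∀ u ∈ xs.image (fun x => x ^ 2), 0 < u ∧ u ≤ r₁ ^ 2 ∧ (fun u => p (Real.sqrt u)) u ≠ 0 := by
    intro u hu
    obtain ⟨x, hx, rfl⟩ := Finset.mem_image.mp hu
    obtain ⟨hx0, hxr, hpx⟩ := hxs x hx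
    refine ⟨by positivity, by gcongr, ?_⟩
    show p (Real.sqrt (x ^ 2)) ≠ 0
    rw [Real.sqrt_sq hx0.le]
    exact hpx
  have hys' : ∀ u ∈ ys.image (fun y => y ^ 2), r₂ ^ 2 ≤ u ∧ (fun u => q (Real.sqrt u)) u ≠ 0 := by
    intro u hu
    obtain ⟨y, hy, rfl⟩ := Finset.mem_image.mp hu
    obtain ⟨hyr, hqy⟩ := hys y hy
    have hy0 : 0 ≤ y := h₂.le.trans hyr
    refine ⟨by gcongr, ?_⟩
    show q (Real.sqrt (y ^ 2)) ≠ 0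
    rw [Real.sqrt_sq hy0]
    exact hqy
  obtain ⟨L, κ, hκ, hl, hr⟩ := exists_move_signs (fun u => p (Real.sqrt u)) (fun u => q (Real.sqrt u))
    (xs.image (fun x => x ^ 2)) (ys.image (fun y => y ^ 2)) (r₁ := r₁ ^ 2) (r₂ := r₂ ^ 2) (by positivity)
    (by gcongr) hxs' hys'
  refine ⟨L, κ, hκ, fun x hx => ?_, fun y hy => ?_⟩
  · have hx0 : 0 ≤ x := (hxs x hx).1.le
    have key := hl (x ^ 2) (Finset.mem_image_of_mem _ hx)
    simp only [Real.sqrt_sq hx0, ← pow_mul] at key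
    exact key
  · have hy0 : 0 ≤ y := h₂.le.trans (hys y hy).1
    have key := hr (y ^ 2) (Finset.mem_image_of_mem _ hy)
    simp only [Real.sqrt_sq hy0, ← pow_mul] at key
    exact key

/-! ### Splitting a sign change at its first / last zero -/

/-- **First-zero split.**  `q, h` continuous; `q` has sign `s` at `a` and sign `−s` at `b` (`a < b`); at every zero of `q` in `[a, b]` the
function `h` has sign `u`.  Then some `w ∈ (a, b)` has: `q` of sign `s` on all of `[a, w]`, and `h w` of sign `u`.
(Take the first zero `z = sInf {x ∈ [a,b] | s·q x ≤ 0}` of `q`; `h z` has sign `u`, so does `h` slightly left of `z`.) [folklore] -/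
theorem exists_split_first {q h : ℝ → ℝ} (hq : Continuous q) (hh : Continuous h) {a b s u : ℝ} (hab : a < b)
    (hqa : 0 < s * q a) (hqb : s * q b < 0) (hkey : ∀ z ∈ Icc a b, q z = 0 → 0 < u * h z) :
    ∃ w ∈ Ioo a b, (∀ x ∈ Icc a w, 0 < s * q x) ∧ 0 < u * h w := by
  set S : Set ℝ := Icc a b ∩ {x | s * q x ≤ 0} with hS
  have hSclosed : IsClosed S := isClosed_Icc.inter (isClosed_le (continuous_const.mul hq) continuous_const)
  have hbS : b ∈ S := ⟨right_mem_Icc.mpr hab.le, hqb.le⟩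
  have hSne : S.Nonempty := ⟨b, hbS⟩
  have hSbdd : BddBelow S := ⟨a, fun x hx => hx.1.1⟩
  set z := sInf S with hz
  have hzS : z ∈ S := hSclosed.csInf_mem hSne hSbdd
  have haz : a ≤ z := hzS.1.1
  have hzb : z ≤ b := hzS.1.2
  have hza : a ≠ z := by
    intro h; rw [← h] at hzS; exact absurd hzS.2 (not_le.mpr hqa)
  have haz' : a < z := lt_of_le_of_ne haz hza
  -- left of `z` (inside `[a, b]`) the sign of `q` is `s`
  have hleft : ∀ x ∈ Icc a b, x < z → 0 < s * q x := by
    intro x hx hxz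
    by_contra hcon
    have hxS : x ∈ S := ⟨hx, not_lt.mp hcon⟩
    exact absurd (csInf_le hSbdd hxS) (not_le.mpr hxz)
  -- `q z = 0`
  have hqz : q z = 0 := by
    have hle : s * q z ≤ 0 := hzS.2
    by_contra hne
    have hlt : s * q z < 0 := by
      rcases lt_or_eq_of_le hle with h | h
      · exact h
      · exfalso
        have hs0 : s ≠ 0 := by intro h0; rw [h0, zero_mul] at hqa; exact lt_irrefl _ hqa
        exact hne (by rcases mul_eq_zero.mp h with h | h; exact absurd h hs0; exact h)
    -- continuity of `s * q` at `z` contradicts the sign on the left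
    have hcont : ContinuousAt (fun x => s * q x) z := (continuous_const.mul hq).continuousAt
    have hev : ∀ᶠ x in nhds z, s * q x < 0 := hcont.eventually (gt_mem_nhds hlt)
    obtain ⟨δ, hδ, hball⟩ := Metric.eventually_nhds_iff.mp hev
    set x := max a (z - δ / 2) with hx
    have hxz : x < z := max_lt haz' (by linarith)
    have hxa : a ≤ x := le_max_left _ _
    have hdist : dist x z < δ := by
      rw [Real.dist_eq, abs_sub_comm, abs_of_pos (by linarith)]
      have : z - δ / 2 ≤ x := le_max_right _ _
      linarith
    have h1 := hball hdist
    have h2 := hleft x ⟨hxa, hxz.le.trans hzb⟩ hxz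
    linarith
  have hhz : 0 < u * h z := hkey z ⟨haz, hzb⟩ hqz
  -- continuity of `u * h` at `z`: positive on a ball
  have hcont : ContinuousAt (fun x => u * h x) z := (continuous_const.mul hh).continuousAt
  obtain ⟨δ, hδ, hball⟩ := Metric.eventually_nhds_iff.mp (hcont.eventually (lt_mem_nhds hhz))
  set w := max ((a + z) / 2) (z - δ / 2) with hw
  have hwz : w < z := max_lt (by linarith) (by linarith)
  have haw : a < w := lt_of_lt_of_le (by linarith) (le_max_left _ _)
  refine ⟨w, ⟨haw, hwz.trans_le hzb⟩, fun x hx => hleft x ⟨hx.1, (hx.2.trans hwz.le).trans hzb⟩ (hx.2.trans_lt hwz), ?_⟩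
  apply hball
  rw [Real.dist_eq, abs_sub_comm, abs_of_pos (by linarith)]
  have : z - δ / 2 ≤ w := le_max_right _ _
  linarith

/-- **Last-zero split** (mirror image of `exists_split_first` under `x ↦ −x`): `q` has sign `−t` at `a` and `t` at `b`; at every zero of
`q` in `[a, b]`, `h` has sign `u`.  Then some `w ∈ (a, b)` has `q` of sign `t` on all of `[w, b]` and `u·h w > 0`. [folklore] -/
theorem exists_split_last {q h : ℝ → ℝ} (hq : Continuous q) (hh : Continuous h) {a b t u : ℝ} (hab : a < b)
    (hqa : t * q a < 0) (hqb : 0 < t * q b) (hkey : ∀ z ∈ Icc a b, q z = 0 → 0 < u * h z) :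
    ∃ w ∈ Ioo a b, (∀ x ∈ Icc w b, 0 < t * q x) ∧ 0 < u * h w := by
  obtain ⟨w, hw, hwq, hwh⟩ := exists_split_first (q := fun x => q (-x)) (h := fun x => h (-x))
    (hq.comp continuous_neg) (hh.comp continuous_neg) (a := -b) (b := -a) (s := t) (u := u)
    (by linarith) (by simpa using hqb) (by simpa using hqa) (fun z hz hqz => hkey (-z) ⟨by linarith [hz.2], by linarith [hz.1]⟩ hqz)
  refine ⟨-w, ⟨by linarith [hw.2], by linarith [hw.1]⟩, fun x hx => ?_, by simpa using hwh⟩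
  have := hwq (-x) ⟨by linarith [hx.2], by linarith [hx.1]⟩
  simpa using this

/-! ### Fresh sample points next to a point with known signs -/

/-- A point slightly to the RIGHT of `b` (and left of `g`) at which two continuous functions keep the signs they have at `b`. [folklore] -/
theorem exists_point_right₂ {p q : ℝ → ℝ} (hp : Continuous p) (hq : Continuous q) {b g s t : ℝ} (hbg : b < g)
    (hpb : 0 < s * p b) (hqb : 0 < t * q b) :
    ∃ v ∈ Ioo b g, 0 < s * p v ∧ 0 < t * q v := by
  have hev : ∀ᶠ x in nhds b, 0 < s * p x ∧ 0 < t * q x :=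
    (((continuous_const.mul hp).continuousAt.eventually (lt_mem_nhds hpb)).and
      ((continuous_const.mul hq).continuousAt.eventually (lt_mem_nhds hqb)))
  obtain ⟨δ, hδ, hball⟩ := Metric.eventually_nhds_iff.mp hev
  set v := min ((b + g) / 2) (b + δ / 2) with hv
  have hbv : b < v := lt_min (by linarith) (by linarith)
  have hvg : v < g := lt_of_le_of_lt (min_le_left _ _) (by linarith)
  refine ⟨v, ⟨hbv, hvg⟩, hball ?_⟩
  rw [Real.dist_eq, abs_of_pos (by linarith)]
  have : v ≤ b + δ / 2 := min_le_right _ _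
  linarith

/-- A point slightly to the LEFT of `a` (and right of `l`) at which a continuous function keeps the sign it has at `a`. [folklore] -/
theorem exists_point_left {p : ℝ → ℝ} (hp : Continuous p) {l a s : ℝ} (hla : l < a) (hpa : 0 < s * p a) :
    ∃ x ∈ Ioo l a, 0 < s * p x := by
  have hev : ∀ᶠ x in nhds a, 0 < s * p x := (continuous_const.mul hp).continuousAt.eventually (lt_mem_nhds hpa)
  obtain ⟨δ, hδ, hball⟩ := Metric.eventually_nhds_iff.mp hev
  set x := max ((l + a) / 2) (a - δ / 2) with hx
  have hxa : x < a := max_lt (by linarith) (by linarith)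
  have hlx : l < x := lt_of_lt_of_le (by linarith) (le_max_left _ _)
  refine ⟨x, ⟨hlx, hxa⟩, hball ?_⟩
  rw [Real.dist_eq, abs_sub_comm, abs_of_pos (by linarith)]
  have : a - δ / 2 ≤ x := le_max_right _ _
  linarith

/-! ### Alternation along a list of sample points -/

/-- Along a list with at least two entries on which `f` alternates in sign, `f` vanishes nowhere. [folklore] -/
theorem ne_zero_of_isChain_alt {f : ℝ → ℝ} {a b : ℝ} {l : List ℝ}
    (h : (a :: b :: l).IsChain (fun x y => f x * f y < 0)) : ∀ x ∈ a :: b :: l, f x ≠ 0 := by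
  induction l generalizing a b with
  | nil =>
    have hab : f a * f b < 0 := (List.isChain_cons_cons.mp h).1
    intro x hx
    simp only [List.mem_cons, List.not_mem_nil, or_false] at hx
    rcases hx with rfl | rfl
    · intro h0; rw [h0, zero_mul] at hab; exact lt_irrefl _ hab
    · intro h0; rw [h0, mul_zero] at hab; exact lt_irrefl _ hab
  | cons c l ih =>
    have hab : f a * f b < 0 := (List.isChain_cons_cons.mp h).1
    have htail := ih (List.isChain_cons_cons.mp h).2
    intro x hx
    rcases List.mem_cons.mp hx with rfl | hx
    · intro h0; rw [h0, zero_mul] at hab; exact lt_irrefl _ hab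
    · exact htail x hx

/-- Sign-pattern transfer: if `c · f x · g x > 0` at every point of the list (one fixed `c`), then `f` alternates along the list iff `g`
does. [folklore] -/
theorem isChain_alt_congr {f g : ℝ → ℝ} {c : ℝ} {l : List ℝ} (hfg : ∀ x ∈ l, 0 < c * (f x * g x)) :
    l.IsChain (fun x y => f x * f y < 0) ↔ l.IsChain (fun x y => g x * g y < 0) := by
  refine List.IsChain.iff_of_mem_imp fun a b ha hb => ?_
  have h1 := hfg a ha
  have h2 := hfg b hb
  have hc : c ≠ 0 := by
    intro h0; rw [h0, zero_mul] at h1; exact lt_irrefl _ h1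
  have hc2 : 0 < c ^ 2 := by positivity
  have hprod : 0 < (f a * f b) * (g a * g b) := by
    have h12 := mul_pos h1 h2
    have : c * (f a * g a) * (c * (f b * g b)) = c ^ 2 * ((f a * f b) * (g a * g b)) := by ring
    rw [this] at h12
    exact pos_of_mul_pos_right h12 hc2.le
  constructor
  · intro hf
    by_contra hg
    push Not at hg
    nlinarith [hprod]
  · intro hg
    by_contra hf
    push Not at hf
    nlinarith [hprod]

/-- **List form of the alternation certificate.**  A strictly increasing list of positive points along which the polynomial `P`
alternates in sign certifies `length − 1` distinct positive roots of `P`. [folklore: intermediate values; the tree's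
`le_card_posRoots_of_alternating`] -/
theorem le_card_posRoots_of_isChain (P : Polynomial ℝ) (l : List ℝ) (hlt : l.IsChain (· < ·)) (hpos : ∀ x ∈ l, 0 < x)
    (halt : l.IsChain (fun x y => P.eval x * P.eval y < 0)) :
    l.length - 1 ≤ (P.roots.toFinset.filter (fun t => 0 < t)).card := by
  rcases l with _ | ⟨a, l⟩
  · simp
  · set N := l.length with hN
    have hlen : (a :: l).length = N + 1 := by simp [hN]
    have hres : (a :: l).length - 1 = N := by simp [hN]
    rw [hres]
    have hpw : (a :: l).Pairwise (· < ·) := List.isChain_iff_pairwise.mp hlt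
    refine le_card_posRoots_of_alternating P N (fun j => (a :: l).get (j.cast hlen.symm)) ?_ ?_ ?_
    · intro i j hij
      exact hpw.rel_get_of_lt hij
    · intro j
      exact hpos _ (List.get_mem _ _)
    · intro j
      have hj : j.val + 1 < (a :: l).length := by
        have := j.isLt
        rw [hlen]; omega
      have h := (List.isChain_iff_getElem.mp halt) j.val hj
      simpa [List.get_eq_getElem] using h

end Summit.ValiantsHypothesis.ValiantsHypothesis.Theorems.KPlusLogSqLaw.StaticTridiagonalRealLadder
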